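import Summits.ABC.ABC.Theses.ParsevalSymbolDictionary
import HarnessLib

/-!
# Route ParsevalSymbolDictionary — glue item `SymbolMeanSquareLowerBoundGlue` (stmt-ABC-22753)

`symbolMeanSquareLowerBoundGlue_proof :
  AdditiveFirstMomentPlus → AdditiveFirstMomentMinus → SymbolMeanSquareLowerBound`
(the K2 split of route `ParsevalSymbolDictionary`, children ⟹ parent, with `c = 9/64`).

## Proof

* `sq_sum_lower_of_weighted` (Cauchy–Schwarz, `Finset.sum_mul_sq_le_sq_mul_sq`): if
  `Σ_{a<q} s_a · w_a ≥ 3q/8` with weights `w_a² ≤ 1` (here `cos (2πa/q)`, `sin (2πa/q)`), then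
  `(3q/8)² ≤ (Σ s_a w_a)² ≤ (Σ s_a²) · (Σ w_a²) ≤ (Σ s_a²) · q`, so `Σ_{a<q} s_a² ≥ 9q/64`.
* Bertrand (`Nat.exists_prime_lt_and_le_two_mul`): for `N ≥ 2` there is a prime `q` with
  `N⁴ < q ≤ 2·N⁴ ≤ N⁵`, i.e. a prime in the window `[N⁴, N⁵]` of the parent statement.
* `N₀ := max (max N₀⁺ N₀⁻) 2`.

Elementary bookkeeping of a support split (abc-idea-1's K2 split, certified by the route planner in
scratch; re-derived here). The route is STRUCK at K1; this file has no abc content and proves no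
conjecture — an implication between typed statements only. A-PS is NOT abc («NOT abc —
POLY-SZPIRO(E)»); typed ≠ proved.
-/

-- `Summit.<Summit>.<Problem>` is the mandated summit-side namespace (CONVENTIONS §2); for the
-- single-conjunct summit ABC the problem is also `ABC`, hence the duplicated component.
set_option linter.dupNamespace false

namespace Summit.ABC.ABC.Theorems

open Summit.ABC.ABC.Theses.ParsevalSymbolDictionary

/-- Cauchy–Schwarz step of the glue: a first moment `Σ_{a<q} s_a · w_a ≥ 3q/8` against weights with
`w_a² ≤ 1` forces the mean square `Σ_{a<q} s_a² ≥ 9q/64`. -/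
theorem sq_sum_lower_of_weighted (q : ℕ) (s w : ℕ → ℝ) (hw : ∀ a, w a ^ 2 ≤ 1)
    (h : (3 / 8 : ℝ) * q ≤ ∑ a ∈ Finset.range q, s a * w a) :
    (9 / 64 : ℝ) * q ≤ ∑ a ∈ Finset.range q, s a ^ 2 := by
  have hcs := Finset.sum_mul_sq_le_sq_mul_sq (Finset.range q) s w
  have hwq : ∑ a ∈ Finset.range q, w a ^ 2 ≤ q := by
    calc ∑ a ∈ Finset.range q, w a ^ 2 ≤ ∑ _a ∈ Finset.range q, (1 : ℝ) :=
          Finset.sum_le_sum fun a _ => hw a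
      _ = q := by simp
  have hS : 0 ≤ ∑ a ∈ Finset.range q, s a ^ 2 := Finset.sum_nonneg fun a _ => sq_nonneg _
  have hq : (0 : ℝ) ≤ q := Nat.cast_nonneg q
  have h0 : 0 ≤ (3 / 8 : ℝ) * q := by positivity
  have h1 : ((3 / 8 : ℝ) * q) ^ 2 ≤ (∑ a ∈ Finset.range q, s a ^ 2) * q :=
    calc ((3 / 8 : ℝ) * q) ^ 2 ≤ (∑ a ∈ Finset.range q, s a * w a) ^ 2 := pow_le_pow_left₀ h0 h 2
      _ ≤ (∑ a ∈ Finset.range q, s a ^ 2) * ∑ a ∈ Finset.range q, w a ^ 2 := hcs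
      _ ≤ (∑ a ∈ Finset.range q, s a ^ 2) * q := by gcongr
  nlinarith [h1, hS, hq]

/-- Bertrand step of the glue: for `N ≥ 2` there is a prime `q` with `N⁴ ≤ q ≤ N⁵`. -/
theorem exists_prime_mem_window (N : ℕ) (hN : 2 ≤ N) :
    ∃ q : ℕ, q.Prime ∧ N ^ 4 ≤ q ∧ q ≤ N ^ 5 := by
  have hN4 : N ^ 4 ≠ 0 := pow_ne_zero 4 (by omega)
  obtain ⟨q, hq, hlt, hle⟩ := Nat.exists_prime_lt_and_le_two_mul (N ^ 4) hN4
  refine ⟨q, hq, hlt.le, hle.trans ?_⟩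
  calc 2 * N ^ 4 ≤ N * N ^ 4 := Nat.mul_le_mul_right _ hN
    _ = N ^ 5 := by ring

/-- **Glue of the K2 split** (item stmt-ABC-22753): the two level-uniform additive first moments
(`AdditiveFirstMomentPlus`, `AdditiveFirstMomentMinus`: `Σ_a Re⟨a/q⟩·cos(2πa/q) ≥ 3q/8` and
`Σ_a Im⟨a/q⟩·sin(2πa/q) ≥ 3q/8` at every prime `q ∈ [N⁴, N⁵]`, `N ≥ N₀^±`) imply the parent crux
`SymbolMeanSquareLowerBound` with `c = 9/64` and `N₀ = max (max N₀⁺ N₀⁻) 2`: Cauchy–Schwarz against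
the weights (`cos² ≤ 1`, `sin² ≤ 1`) and a Bertrand prime `q ∈ (N⁴, 2N⁴] ⊆ [N⁴, N⁵]`. Support
structure of a line STRUCK at K1; no abc content; typed ≠ proved. -/
theorem symbolMeanSquareLowerBoundGlue_proof : SymbolMeanSquareLowerBoundGlue := by
  unfold SymbolMeanSquareLowerBoundGlue
  rintro ⟨N₁, h₁⟩ ⟨N₂, h₂⟩
  refine ⟨9 / 64, by norm_num, max (max N₁ N₂) 2, ?_⟩
  intro W _ N _ Dt hcond hN
  have hN2 : 2 ≤ N := le_trans (le_max_right _ _) hN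
  have hN₁ : N₁ ≤ N := le_trans (le_trans (le_max_left _ _) (le_max_left _ _)) hN
  have hN₂ : N₂ ≤ N := le_trans (le_trans (le_max_right _ _) (le_max_left _ _)) hN
  obtain ⟨q, hq, hq4, hq5⟩ := exists_prime_mem_window N hN2
  refine ⟨q, hq, hq4, hq5, ?_, ?_⟩
  · exact sq_sum_lower_of_weighted q
      (fun a => (Literature.NumberTheory.EllipticCurves.ModularForms.plusSymbol Dt.f
        ((a : ℚ) / q)).re)
      (fun a => Real.cos (2 * Real.pi * a / q))
      (fun a => (sq_le_one_iff_abs_le_one _).mpr (Real.abs_cos_le_one _))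
      (h₁ W N Dt hcond hN₁ q hq hq4 hq5)
  · exact sq_sum_lower_of_weighted q
      (fun a => (Literature.NumberTheory.EllipticCurves.ModularForms.minusSymbol Dt.f
        ((a : ℚ) / q)).im)
      (fun a => Real.sin (2 * Real.pi * a / q))
      (fun a => (sq_le_one_iff_abs_le_one _).mpr (Real.abs_sin_le_one _))
      (h₂ W N Dt hcond hN₂ q hq hq4 hq5)

end Summit.ABC.ABC.Theorems
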